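import Summits.HubbardSuperconductivity.HubbardSuperconductivity.Theses.CooperSharpness

/-!
# Route `CooperSharpness` — support item `DichotomyGivesGrowth` (stmt-HubbardSuperconductivity-12851)

The alternative deciding chain, pure logic: `SharpnessDichotomy` gives `(U₀, γ)`;
`CooperThreshold` at `(U₀, γ)` gives `(U, δ, g₀)` with `U ∈ (0, U₀)`, `g₀ ∈ [-γ, 0)` and the
every-ground-state divergence of the torus pair susceptibility per site; `SharpnessDichotomy`
returns `b`, `η`, `L₀` and the growth law on `[g₀/2, 0]`, which is `CooperCoordinateGrowth` with
threshold coupling `g₀/2 < 0`.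

Sources: M. Aizenman, D. J. Barsky, Comm. Math. Phys. 108 (1987) 489; H. Duminil-Copin,
V. Tassion, Comm. Math. Phys. 343 (2016) 725 (the shape "χ = ∞ ⇒ mean-field bound"). No new
definitions.
-/

-- the mandated namespace `Summit.<Summit>.<Problem>.Theorems` repeats `HubbardSuperconductivity`
-- (single-problem summit, D-0017), which the `dupNamespace` linter flags on every declaration
set_option linter.dupNamespace false

namespace Summit.HubbardSuperconductivity.HubbardSuperconductivity.Theorems.CooperSharpness

open Summit.HubbardSuperconductivity.HubbardSuperconductivity.Theses.CooperSharpness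

/-- **`DichotomyGivesGrowth`** (stmt-HubbardSuperconductivity-12851):
`SharpnessDichotomy → CooperThreshold → CooperCoordinateGrowth`, by instantiating the threshold
at the dichotomy's `(U₀, γ)` and the dichotomy at the threshold's `(U, δ, g₀)`; the growth law on
`[g₀/2, 0]` is the target with `g₀/2 < 0`. [folklore] -/
theorem dichotomyGivesGrowth_proof :
    Summit.HubbardSuperconductivity.HubbardSuperconductivity.Theses.CooperSharpness.DichotomyGivesGrowth := by
  intro hD hT
  obtain ⟨U₀, hU₀, γ, hγ, hdich⟩ := hD
  obtain ⟨U, hU, δ, hδ, g₀, hg₀, hdiv⟩ := hT U₀ hU₀ γ hγ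
  obtain ⟨b, hb, η, hη, L₀, hlaw⟩ := hdich U hU δ hδ g₀ hg₀ hdiv
  exact ⟨U, hU.1, δ, hδ, g₀ / 2, by linarith [hg₀.2], b, hb, η, hη, L₀, hlaw⟩

end Summit.HubbardSuperconductivity.HubbardSuperconductivity.Theorems.CooperSharpness
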